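import Mathlib.Analysis.InnerProductSpace.Basic
import Mathlib.Analysis.Calculus.MeanValue
import HarnessLib

/-!
# Angular estimates for the interior surgery map: drift-perturbed directions

Topic `Geometry/Riemannian` (elementary inner-product-space algebra). The direction field of the
interior surgery map of Weinstein's disk (Weinstein 1968, proof of the main theorem, step (3)) is
`Θ(ρ, u) = N(u + c(ρ) e_ρ(u))` on unit vectors `u`, with the normalisation `N x = x/‖x‖`, a
coefficient `c ∈ [0, 1]` and a small drift `e` (`‖e‖ ≤ κ`, `κ`-Lipschitz on close unit vectors).
This file provides the three angular hypotheses of the shell lemma (`PolarGraphInjective.lean`)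
by pure algebra:

* normalisation algebra: `norm_normalize_sub_normalize_le_four_mul` (`N` is `4`-Lipschitz on
  `‖x‖ ≥ 1/2`), `sub_le_norm_mul_norm_normalize_sub` (`‖x - y‖ - |‖x‖ - ‖y‖| ≤ ‖x‖ ‖N x - N y‖`),
  `norm_normalize_sub_self` (`‖N x - x‖ = |1 - ‖x‖|`);
* `norm_normalize_perturb_sub_ge` — **co-Lipschitz**: `‖Θ u' - Θ u‖ ≥ ½ ‖u' - u‖` for close unit
  vectors when `κ ≤ 1/16` (hypothesis `hΘinj`, `m = 1/2`);
* `norm_normalize_perturb_sub_self_le` — `‖Θ u - u‖ ≤ 2κ` (hypothesis `hΘnear`);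
* `norm_normalize_perturb_sub_perturb_le` — **`ρ`-Lipschitz**: for `Θ(ρ) = N(a + c(ρ) f(ρ))`
  with `|c(ρ') - c(ρ)| ≤ C_c|ρ' - ρ|`, `‖f‖ ≤ κ ≤ 1/2`, `‖f(ρ') - f(ρ)‖ ≤ L|ρ' - ρ|`:
  `‖Θ(ρ') - Θ(ρ)‖ ≤ 4(C_c κ + L)|ρ' - ρ|` (hypothesis `hΘρ`);
* `abs_sub_le_of_abs_deriv_le` — a real function with `|f'| ≤ C` is `C`-Lipschitz (for the
  step `χ` and the clamp).

## References

* A. Weinstein, Ann. of Math. (2) 87 (1968), 29–41. [cite: Weinstein1968]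

Tags: [PolarGraph] [Weinstein1968]
-/

noncomputable section

open Set Function Metric
open scoped RealInnerProductSpace

namespace Literature.Geometry.Riemannian

variable {V : Type*} [NormedAddCommGroup V] [InnerProductSpace ℝ V]

/-! ### Normalisation algebra -/

/-- `N x - N y = ‖x‖⁻¹ (x - y) + (‖x‖⁻¹ - ‖y‖⁻¹) y`. [folklore] -/
theorem normalize_sub_normalize (x y : V) :
    ‖x‖⁻¹ • x - ‖y‖⁻¹ • y = ‖x‖⁻¹ • (x - y) + (‖x‖⁻¹ - ‖y‖⁻¹) • y := by
  rw [smul_sub, sub_smul]; abel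

/-- **`N` is `4`-Lipschitz on `{‖x‖ ≥ 1/2}`.** [folklore] -/
theorem norm_normalize_sub_normalize_le_four_mul {x y : V} (hx : 1 / 2 ≤ ‖x‖) (hy : 1 / 2 ≤ ‖y‖) :
    ‖‖x‖⁻¹ • x - ‖y‖⁻¹ • y‖ ≤ 4 * ‖x - y‖ := by
  have hx0 : 0 < ‖x‖ := by linarith
  have hy0 : 0 < ‖y‖ := by linarith
  rw [normalize_sub_normalize]
  have h1 : ‖‖x‖⁻¹ • (x - y)‖ ≤ 2 * ‖x - y‖ := by
    rw [norm_smul, norm_inv, norm_norm]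
    apply mul_le_mul_of_nonneg_right _ (norm_nonneg _)
    rw [inv_le_comm₀ hx0 (by norm_num)]; linarith
  have h2 : ‖(‖x‖⁻¹ - ‖y‖⁻¹) • y‖ ≤ 2 * ‖x - y‖ := by
    rw [norm_smul, Real.norm_eq_abs]
    have e : ‖x‖⁻¹ - ‖y‖⁻¹ = (‖y‖ - ‖x‖) / (‖x‖ * ‖y‖) := by field_simp
    rw [e, abs_div, abs_of_pos (mul_pos hx0 hy0), div_mul_eq_mul_div, div_le_iff₀ (mul_pos hx0 hy0)]
    have h3 : |‖y‖ - ‖x‖| ≤ ‖x - y‖ := by rw [abs_sub_comm]; exact abs_norm_sub_norm_le x y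
    calc |‖y‖ - ‖x‖| * ‖y‖ ≤ ‖x - y‖ * ‖y‖ := mul_le_mul_of_nonneg_right h3 (norm_nonneg _)
      _ ≤ 2 * ‖x - y‖ * (‖x‖ * ‖y‖) := by
          have : ‖x - y‖ * ‖y‖ * 1 ≤ ‖x - y‖ * ‖y‖ * (2 * ‖x‖) :=
            mul_le_mul_of_nonneg_left (by linarith) (by positivity)
          nlinarith
  exact (norm_add_le _ _).trans (by linarith)

/-- **`‖x - y‖ - |‖x‖ - ‖y‖| ≤ ‖x‖ ‖N x - N y‖`** for `x, y ≠ 0`. [folklore] -/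
theorem sub_le_norm_mul_norm_normalize_sub {x y : V} (hx : x ≠ 0) (hy : y ≠ 0) :
    ‖x - y‖ - |‖x‖ - ‖y‖| ≤ ‖x‖ * ‖‖x‖⁻¹ • x - ‖y‖⁻¹ • y‖ := by
  have hx0 : 0 < ‖x‖ := norm_pos_iff.2 hx
  have hy0 : 0 < ‖y‖ := norm_pos_iff.2 hy
  -- `‖x‖ (N x - N y) = (x - y) + (1 - ‖x‖/‖y‖) y`
  have e : ‖x‖ • (‖x‖⁻¹ • x - ‖y‖⁻¹ • y) = (x - y) + (1 - ‖x‖ * ‖y‖⁻¹) • y := by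
    rw [smul_sub, smul_smul, smul_smul, mul_inv_cancel₀ hx0.ne', one_smul, sub_smul, one_smul]
    abel
  have h1 : ‖x - y‖ - ‖(1 - ‖x‖ * ‖y‖⁻¹) • y‖ ≤ ‖‖x‖ • (‖x‖⁻¹ • x - ‖y‖⁻¹ • y)‖ := by
    rw [e]
    have := norm_sub_le ((x - y) + (1 - ‖x‖ * ‖y‖⁻¹) • y) ((1 - ‖x‖ * ‖y‖⁻¹) • y)
    rw [add_sub_cancel_right] at this
    linarith
  have h2 : ‖(1 - ‖x‖ * ‖y‖⁻¹) • y‖ = |‖x‖ - ‖y‖| := by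
    rw [norm_smul, Real.norm_eq_abs]
    have e2 : (1 - ‖x‖ * ‖y‖⁻¹) = (‖y‖ - ‖x‖) / ‖y‖ := by field_simp
    rw [e2, abs_div, abs_of_pos hy0, div_mul_cancel₀ _ hy0.ne', abs_sub_comm]
  have h3 : ‖‖x‖ • (‖x‖⁻¹ • x - ‖y‖⁻¹ • y)‖ = ‖x‖ * ‖‖x‖⁻¹ • x - ‖y‖⁻¹ • y‖ := by
    rw [norm_smul ‖x‖ (‖x‖⁻¹ • x - ‖y‖⁻¹ • y), Real.norm_eq_abs, abs_of_pos hx0]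
  rw [h2, h3] at h1
  exact h1

/-- **`‖N x - x‖ = |1 - ‖x‖|`** for `x ≠ 0`. [folklore] -/
theorem norm_normalize_sub_self {x : V} (hx : x ≠ 0) : ‖‖x‖⁻¹ • x - x‖ = |1 - ‖x‖| := by
  have hx0 : 0 < ‖x‖ := norm_pos_iff.2 hx
  have e : ‖x‖⁻¹ • x - x = (‖x‖⁻¹ - 1) • x := by rw [sub_smul, one_smul]
  rw [e, norm_smul, Real.norm_eq_abs]
  have e2 : ‖x‖⁻¹ - 1 = (1 - ‖x‖) / ‖x‖ := by field_simp
  rw [e2, abs_div, abs_of_pos hx0, div_mul_cancel₀ _ hx0.ne']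

/-! ### Perturbed directions `Θ u = N(u + c e(u))` -/

/-- Norm bounds for `P u = u + c e(u)`: `1 - κ ≤ ‖P u‖ ≤ 1 + κ`. [folklore] -/
theorem norm_perturb_bounds {u eu : V} {c κ : ℝ} (hu : ‖u‖ = 1) (hc0 : 0 ≤ c) (hc1 : c ≤ 1)
    (he : ‖eu‖ ≤ κ) : 1 - κ ≤ ‖u + c • eu‖ ∧ ‖u + c • eu‖ ≤ 1 + κ := by
  have hce : ‖c • eu‖ ≤ κ := by
    rw [norm_smul, Real.norm_eq_abs, abs_of_nonneg hc0]
    calc c * ‖eu‖ ≤ 1 * κ := mul_le_mul hc1 he (norm_nonneg _) zero_le_one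
      _ = κ := one_mul κ
  constructor
  · have := norm_sub_norm_le u (-(c • eu))
    rw [sub_neg_eq_add, norm_neg, hu] at this
    linarith
  · exact (norm_add_le _ _).trans (by rw [hu]; linarith)

/-- **`|‖P u'‖ - ‖P u‖| ≤ 5κ ‖u' - u‖`** for unit `u, u'`, `‖e‖ ≤ κ ≤ 1/2`, `e` `κ`-Lipschitz on the
pair. [folklore] -/
theorem abs_norm_perturb_sub_le {u u' eu eu' : V} {c κ : ℝ} (hu : ‖u‖ = 1) (hu' : ‖u'‖ = 1)
    (hc0 : 0 ≤ c) (hc1 : c ≤ 1) (hκ : 0 ≤ κ) (hκ1 : κ ≤ 1 / 2) (he : ‖eu‖ ≤ κ) (he' : ‖eu'‖ ≤ κ)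
    (hlip : ‖eu' - eu‖ ≤ κ * ‖u' - u‖) :
    |‖u' + c • eu'‖ - ‖u + c • eu‖| ≤ 5 * κ * ‖u' - u‖ := by
  -- squares: `‖P u‖² = 1 + 2c⟪u, e u⟫ + c²‖e u‖²`
  have hsq : ∀ (v ev : V), ‖v‖ = 1 → ‖v + c • ev‖ ^ 2 = 1 + 2 * c * ⟪v, ev⟫ + c ^ 2 * ‖ev‖ ^ 2 := by
    intro v ev hv
    rw [@norm_add_sq_real, hv, norm_smul, Real.norm_eq_abs, abs_of_nonneg hc0, inner_smul_right]
    ring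
  have hd : ‖u' + c • eu'‖ ^ 2 - ‖u + c • eu‖ ^ 2 =
      2 * c * (⟪u', eu'⟫ - ⟪u, eu⟫) + c ^ 2 * (‖eu'‖ ^ 2 - ‖eu‖ ^ 2) := by
    rw [hsq u' eu' hu', hsq u eu hu]; ring
  -- `|⟪u', e u'⟫ - ⟪u, e u⟫| ≤ 2κ‖u' - u‖`
  have h1 : |⟪u', eu'⟫ - ⟪u, eu⟫| ≤ 2 * κ * ‖u' - u‖ := by
    have e : ⟪u', eu'⟫ - ⟪u, eu⟫ = ⟪u' - u, eu'⟫ + ⟪u, eu' - eu⟫ := by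
      rw [inner_sub_left, inner_sub_right]; ring
    rw [e]
    have a := abs_real_inner_le_norm (u' - u) eu'
    have b := abs_real_inner_le_norm u (eu' - eu)
    rw [hu, one_mul] at b
    calc |⟪u' - u, eu'⟫ + ⟪u, eu' - eu⟫| ≤ |⟪u' - u, eu'⟫| + |⟪u, eu' - eu⟫| := abs_add_le _ _
      _ ≤ ‖u' - u‖ * ‖eu'‖ + ‖eu' - eu‖ := add_le_add a b
      _ ≤ ‖u' - u‖ * κ + κ * ‖u' - u‖ :=
          add_le_add (mul_le_mul_of_nonneg_left he' (norm_nonneg _)) hlip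
      _ = 2 * κ * ‖u' - u‖ := by ring
  -- `|‖e u'‖² - ‖e u‖²| ≤ 2κ · κ‖u' - u‖`
  have h2 : |‖eu'‖ ^ 2 - ‖eu‖ ^ 2| ≤ 2 * κ * (κ * ‖u' - u‖) := by
    have e : ‖eu'‖ ^ 2 - ‖eu‖ ^ 2 = (‖eu'‖ + ‖eu‖) * (‖eu'‖ - ‖eu‖) := by ring
    rw [e, abs_mul, abs_of_nonneg (by positivity)]
    apply mul_le_mul (by linarith) _ (abs_nonneg _) (by positivity)
    exact (abs_norm_sub_norm_le eu' eu).trans hlip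
  -- difference of squares
  have h3 : |‖u' + c • eu'‖ ^ 2 - ‖u + c • eu‖ ^ 2| ≤ 5 * κ * ‖u' - u‖ := by
    rw [hd]
    have hc2 : c ^ 2 ≤ 1 := by nlinarith
    calc |2 * c * (⟪u', eu'⟫ - ⟪u, eu⟫) + c ^ 2 * (‖eu'‖ ^ 2 - ‖eu‖ ^ 2)|
        ≤ |2 * c * (⟪u', eu'⟫ - ⟪u, eu⟫)| + |c ^ 2 * (‖eu'‖ ^ 2 - ‖eu‖ ^ 2)| := abs_add_le _ _
      _ = 2 * c * |⟪u', eu'⟫ - ⟪u, eu⟫| + c ^ 2 * |‖eu'‖ ^ 2 - ‖eu‖ ^ 2| := by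
          rw [abs_mul (2 * c) (⟪u', eu'⟫ - ⟪u, eu⟫), abs_mul (c ^ 2) (‖eu'‖ ^ 2 - ‖eu‖ ^ 2),
            abs_of_nonneg (by positivity : (0 : ℝ) ≤ 2 * c),
            abs_of_nonneg (by positivity : (0 : ℝ) ≤ c ^ 2)]
      _ ≤ 2 * 1 * (2 * κ * ‖u' - u‖) + 1 * (2 * κ * (κ * ‖u' - u‖)) := by
          apply add_le_add
          · exact mul_le_mul (by linarith) h1 (abs_nonneg _) (by norm_num)
          · exact mul_le_mul hc2 h2 (abs_nonneg _) zero_le_one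
      _ = (4 * κ + 2 * κ ^ 2) * ‖u' - u‖ := by ring
      _ ≤ 5 * κ * ‖u' - u‖ := by
          apply mul_le_mul_of_nonneg_right _ (norm_nonneg _)
          nlinarith
  -- divide by `‖P u'‖ + ‖P u‖ ≥ 2(1 - κ) ≥ 1`
  obtain ⟨hl, -⟩ := norm_perturb_bounds hu hc0 hc1 he
  obtain ⟨hl', -⟩ := norm_perturb_bounds hu' hc0 hc1 he'
  have hsum : 1 ≤ ‖u' + c • eu'‖ + ‖u + c • eu‖ := by linarith
  have e : ‖u' + c • eu'‖ - ‖u + c • eu‖ =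
      (‖u' + c • eu'‖ ^ 2 - ‖u + c • eu‖ ^ 2) / (‖u' + c • eu'‖ + ‖u + c • eu‖) := by
    field_simp; ring
  have hpos : (0 : ℝ) < ‖u' + c • eu'‖ + ‖u + c • eu‖ := by linarith
  rw [e, abs_div, abs_of_pos hpos, div_le_iff₀ hpos]
  calc |‖u' + c • eu'‖ ^ 2 - ‖u + c • eu‖ ^ 2| ≤ 5 * κ * ‖u' - u‖ := h3
    _ = 5 * κ * ‖u' - u‖ * 1 := (mul_one _).symm
    _ ≤ 5 * κ * ‖u' - u‖ * (‖u' + c • eu'‖ + ‖u + c • eu‖) :=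
        mul_le_mul_of_nonneg_left hsum (by positivity)

/-- **Co-Lipschitz of the perturbed direction field** (`hΘinj` with `m = 1/2`): for unit `u, u'`,
`c ∈ [0,1]`, `‖e‖ ≤ κ ≤ 1/16`, `‖e u' - e u‖ ≤ κ‖u' - u‖`:
`½‖u' - u‖ ≤ ‖N(u' + c e u') - N(u + c e u)‖`. [cite: Weinstein1968, proof of the main theorem, step (3)] -/
theorem norm_normalize_perturb_sub_ge {u u' eu eu' : V} {c κ : ℝ} (hu : ‖u‖ = 1) (hu' : ‖u'‖ = 1)
    (hc0 : 0 ≤ c) (hc1 : c ≤ 1) (hκ : 0 ≤ κ) (hκ1 : κ ≤ 1 / 16) (he : ‖eu‖ ≤ κ) (he' : ‖eu'‖ ≤ κ)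
    (hlip : ‖eu' - eu‖ ≤ κ * ‖u' - u‖) :
    1 / 2 * ‖u' - u‖ ≤
      ‖‖u' + c • eu'‖⁻¹ • (u' + c • eu') - ‖u + c • eu‖⁻¹ • (u + c • eu)‖ := by
  obtain ⟨hl, hh⟩ := norm_perturb_bounds hu hc0 hc1 he
  obtain ⟨hl', hh'⟩ := norm_perturb_bounds hu' hc0 hc1 he'
  have hP0 : u + c • eu ≠ 0 := by
    intro h; rw [h, norm_zero] at hl; linarith
  have hP0' : u' + c • eu' ≠ 0 := by
    intro h; rw [h, norm_zero] at hl'; linarith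
  -- `‖P u' - P u‖ ≥ (1 - κ)‖u' - u‖`
  have h1 : (1 - κ) * ‖u' - u‖ ≤ ‖(u' + c • eu') - (u + c • eu)‖ := by
    have e : (u' + c • eu') - (u + c • eu) = (u' - u) + c • (eu' - eu) := by
      rw [smul_sub]; abel
    rw [e]
    have h2 : ‖c • (eu' - eu)‖ ≤ κ * ‖u' - u‖ := by
      rw [norm_smul, Real.norm_eq_abs, abs_of_nonneg hc0]
      calc c * ‖eu' - eu‖ ≤ 1 * (κ * ‖u' - u‖) := mul_le_mul hc1 hlip (norm_nonneg _) zero_le_one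
        _ = κ * ‖u' - u‖ := one_mul _
    have := norm_sub_norm_le (u' - u) (-(c • (eu' - eu)))
    rw [sub_neg_eq_add, norm_neg] at this
    nlinarith
  have h2 := abs_norm_perturb_sub_le hu hu' hc0 hc1 hκ (by linarith) he he' hlip
  have h3 := sub_le_norm_mul_norm_normalize_sub hP0' hP0
  -- `(1 - κ)‖u'-u‖ - 5κ‖u'-u‖ ≤ ‖P u'‖ ‖Θ' - Θ‖ ≤ (1 + κ)‖Θ' - Θ‖`
  have h4 : (1 - 6 * κ) * ‖u' - u‖ ≤
      (1 + κ) * ‖‖u' + c • eu'‖⁻¹ • (u' + c • eu') - ‖u + c • eu‖⁻¹ • (u + c • eu)‖ := by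
    have h5 : ‖u' + c • eu'‖ * ‖‖u' + c • eu'‖⁻¹ • (u' + c • eu') - ‖u + c • eu‖⁻¹ • (u + c • eu)‖ ≤
        (1 + κ) * ‖‖u' + c • eu'‖⁻¹ • (u' + c • eu') - ‖u + c • eu‖⁻¹ • (u + c • eu)‖ :=
      mul_le_mul_of_nonneg_right hh' (norm_nonneg _)
    nlinarith [norm_nonneg (u' - u)]
  nlinarith [norm_nonneg (u' - u),
    norm_nonneg (‖u' + c • eu'‖⁻¹ • (u' + c • eu') - ‖u + c • eu‖⁻¹ • (u + c • eu))]

/-- **The perturbed direction is close to `u`** (`hΘnear`): `‖N(u + c e u) - u‖ ≤ 2κ`.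
[folklore] -/
theorem norm_normalize_perturb_sub_self_le {u eu : V} {c κ : ℝ} (hu : ‖u‖ = 1) (hc0 : 0 ≤ c)
    (hc1 : c ≤ 1) (hκ1 : κ < 1) (he : ‖eu‖ ≤ κ) :
    ‖‖u + c • eu‖⁻¹ • (u + c • eu) - u‖ ≤ 2 * κ := by
  obtain ⟨hl, hh⟩ := norm_perturb_bounds hu hc0 hc1 he
  have hP0 : u + c • eu ≠ 0 := by
    intro h; rw [h, norm_zero] at hl; linarith
  have h1 := norm_normalize_sub_self hP0
  have h2 : |1 - ‖u + c • eu‖| ≤ κ := abs_le.2 ⟨by linarith, by linarith⟩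
  have h3 : ‖(u + c • eu) - u‖ ≤ κ := by
    rw [add_sub_cancel_left, norm_smul, Real.norm_eq_abs, abs_of_nonneg hc0]
    calc c * ‖eu‖ ≤ 1 * κ := mul_le_mul hc1 he (norm_nonneg _) zero_le_one
      _ = κ := one_mul κ
  calc ‖‖u + c • eu‖⁻¹ • (u + c • eu) - u‖
      ≤ ‖‖u + c • eu‖⁻¹ • (u + c • eu) - (u + c • eu)‖ + ‖(u + c • eu) - u‖ :=
        norm_sub_le_norm_sub_add_norm_sub _ _ _
    _ ≤ κ + κ := by rw [h1]; exact add_le_add h2 h3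
    _ = 2 * κ := by ring

/-- **`ρ`-Lipschitz of the perturbed direction** (`hΘρ`): for a unit vector `a`,
`Θ(ρ) = N(a + c(ρ) f(ρ))` with `c ∈ [0,1]` `C_c`-Lipschitz on the pair, `‖f‖ ≤ κ ≤ 1/2`,
`‖f(ρ') - f(ρ)‖ ≤ L|ρ' - ρ|`: `‖Θ(ρ') - Θ(ρ)‖ ≤ 4(C_c κ + L)|ρ' - ρ|`. [folklore] -/
theorem norm_normalize_perturb_sub_perturb_le {a f f' : V} {c c' κ Cc L ρ ρ' : ℝ} (ha : ‖a‖ = 1)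
    (hc0 : 0 ≤ c) (hc1 : c ≤ 1) (hc0' : 0 ≤ c') (hc1' : c' ≤ 1) (hκ1 : κ ≤ 1 / 2)
    (hf : ‖f‖ ≤ κ) (hf' : ‖f'‖ ≤ κ) (hcc : |c' - c| ≤ Cc * |ρ' - ρ|) (hff : ‖f' - f‖ ≤ L * |ρ' - ρ|) :
    ‖‖a + c' • f'‖⁻¹ • (a + c' • f') - ‖a + c • f‖⁻¹ • (a + c • f)‖ ≤ 4 * (Cc * κ + L) * |ρ' - ρ| := by
  obtain ⟨hl, -⟩ := norm_perturb_bounds ha hc0 hc1 hf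
  obtain ⟨hl', -⟩ := norm_perturb_bounds ha hc0' hc1' hf'
  have hN := norm_normalize_sub_normalize_le_four_mul (x := a + c' • f') (y := a + c • f) (by linarith)
    (by linarith)
  have hP : ‖(a + c' • f') - (a + c • f)‖ ≤ (Cc * κ + L) * |ρ' - ρ| := by
    have e : (a + c' • f') - (a + c • f) = (c' - c) • f' + c • (f' - f) := by
      rw [sub_smul, smul_sub]; abel
    rw [e]
    calc ‖(c' - c) • f' + c • (f' - f)‖ ≤ ‖(c' - c) • f'‖ + ‖c • (f' - f)‖ := norm_add_le _ _
      _ = |c' - c| * ‖f'‖ + c * ‖f' - f‖ := by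
          rw [norm_smul, norm_smul, Real.norm_eq_abs, Real.norm_eq_abs, abs_of_nonneg hc0]
      _ ≤ Cc * |ρ' - ρ| * κ + 1 * (L * |ρ' - ρ|) :=
          add_le_add (mul_le_mul hcc hf' (norm_nonneg _) ((abs_nonneg _).trans hcc))
            (mul_le_mul hc1 hff (norm_nonneg _) zero_le_one)
      _ = (Cc * κ + L) * |ρ' - ρ| := by ring
  calc _ ≤ 4 * ‖(a + c' • f') - (a + c • f)‖ := hN
    _ ≤ 4 * ((Cc * κ + L) * |ρ' - ρ|) := by linarith
    _ = 4 * (Cc * κ + L) * |ρ' - ρ| := by ring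

/-- **A real function with `|f'| ≤ C` everywhere is `C`-Lipschitz.** [folklore] -/
theorem abs_sub_le_of_abs_deriv_le {f : ℝ → ℝ} (hf : Differentiable ℝ f) {C : ℝ}
    (hC : ∀ x, |deriv f x| ≤ C) (x y : ℝ) : |f y - f x| ≤ C * |y - x| := by
  have h := convex_univ.norm_image_sub_le_of_norm_deriv_le (f := f) (fun z _ ↦ hf z)
    (fun z _ ↦ (Real.norm_eq_abs _).le.trans (hC z)) (mem_univ x) (mem_univ y)
  rwa [Real.norm_eq_abs, Real.norm_eq_abs] at h

end Literature.Geometry.Riemannian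

end
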